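import Summits.HodgeConjecture.HodgeConjecture.Theorems.VHCAbelianSchemesRoadDiagonal
import HarnessLib

/-!
# Road b02 (`VHCAbelianSchemesRoad`, D-0059) — THE `HC_CM`-LOAD-BEARING FORM OF THE DIAGONAL: granted Hodge-for-CM and Lemme 6.3.1
# only, HC for abelian `g`-folds consumes the crux on the diagonal cells `(2m, m)` with `g ≤ m ≤ 2g − 2`, and `HC_AV` from `m ≥ 4` / `m ≥ 6`

research route, not a corollary; conditional on HC_CM plus one named minimal statement.
(cell line: research route conditional on HC_CM; not a corollary; Q11.4-sentence-2 already refuted in dim ≥ 3.)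

THEOREMS ONLY (no definition, no named fact, no sorry). `HC_CM` (`Theses.RankFourFaces.CMAbelianHodge`, or its dimension slice
`∀ A₀, A₀.dim = 2g → Milne1999.CMHodgeHypothesisAt A₀`) is an explicit HYPOTHESIS of §§3–4 — never a cited fact; nothing of the road's
research content (a semiregular twisted carrier) is claimed. Seat ab-andre-2 gen 55, PART X-b (sequel of `VHCAbelianSchemesRoadDiagonal`).

WHAT THIS FILE PROVES. Part X-a showed that the road's crux K-SR♭∃ is consumed, for `HC_AV`, only on its diagonal `(2m, m)`, `m ≥ 3`
(mod Markman ≤ 5), through ring 2's node (U), row b02 and André's Lemmes 6.3.1–6.3.3. Here the `HC_CM`-load-bearing form of André's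
reduction (Lemme 6.3.1 ALONE: through every Hodge class of `A` passes a compact pencil of relative dimension `2·dim A` with a CM fibre,
where `HC_CM` anchors; `Ring2.Deform` §C / Abdulali Lemma 6.2) is threaded with the same per-pencil engine, pencil by pencil:
* §1 the WINDOW engine at fixed relative dimension `n`: on a one-parameter abelian scheme of relative dimension `n` the conclusion of
  node (U) in EVERY mid-range codimension `2 ≤ p ≤ n − 2` follows from the door and the graded crux on the diagonal cells `(2m, m)` with
  `n ≤ 2m`, `m + 2 ≤ n` (lower shadow for `2p > n`, padding by `B` of dimension `n − 2p` for `2p < n`; part X-a's tools); off the middle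
  range every fibre is algebraic (Lefschetz `(1,1)` / hard Lefschetz, part W), so VHC holds on EVERY fibre of such a pencil (thick sets).
* §2 from one-parameter to every base WITH A SECTION at fixed relative dimension `n`: the AnchorTransport curve reduction
  (`Theorems.variationalHodge_of_curveBase_of_stable`, Mumford's lemma PROVED) for the base-change-stable class «fibres abelian OF
  DIMENSION `n` and a section exists» — the dimension clause pins the relative dimension of every base change (`dim_eq_of_iso_fiberOver`),
  so only the window at `n` is consumed; in particular on André's COMPACT pencils (`IsCompactAbelianPencil f n`: they carry a section).
* §3 per abelian variety `A` of dimension `g`: `HodgeConjectureFor A` from Lemme 6.3.1, `HC_CM` AT DIMENSION `2g` (the CM fibre of the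
  pencil), the door, the curve residual and the crux on the window `g ≤ m ≤ 2g − 2` of the diagonal (codimensions `≤ 1`, `≥ g − 1` of `A`
  are divisorial, part W's `mem_algebraicClasses_and_divisorClassesSpan_of_offMidRange`).
* §4 the rows: `HCAtDim g` from the window; `HC_AV` from `HC_CM`, Lemme 6.3.1, the door, the residual and the diagonal cells `m ≥ 4`
  (FACT-FREE otherwise: `g ≤ 3` is `hcAtDim_of_le_three`), resp. `m ≥ 6` granted `HCUpToDim 5` (Markman 2025 Cor. 1.3, UNREFEREED);
  the twisted-door `closes`-shapes. So, in the cell's framing «conditional on HC_CM plus one named minimal statement», the minimal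
  statement this road needs is K-C ∧ door ∧ «regime 2 on the diagonal cells `(2m, m)`, `m ≥ 6`» (mod Markman ≤ 5, Raynaud, Lemme 6.3.1):
  the cells `(6,3)`, `(8,4)`, `(10,5)` of part X-a's list are bought by `HC_CM` (they served only Lemmes 6.3.2–6.3.3's pencils).

NOT claimed: any cell of the crux; `HC_CM`; the converse; that the window is sharp in `m` (the curve reduction is graded by `n` only, so
the cells `(2g, g)`, `(2g+2, g+1)` enter through the «all codimensions at relative dimension `2g`» hypothesis although André's class has
codimension `p ≤ g − 2`; a reduction graded by `(n, p)` would shrink the window to `g + 2 ≤ m ≤ 2g − 2`).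

References: [Andre1996Motifs] Lemme 6.3.1 (p. 31), §6.3 a) (p. 33); [Abdulali1994FamiliesAV] Lemma 6.2; [MumfordAV1970] §6 Lemma;
[BrosnanFangNiePearlstein2009] §6 Lemma 48; [Lieberman1968]; [CharlesSchnell2014Notes] Prop. 11.3.11 (proof), Cor. 11.3.6;
[BuchweitzFlenner2003] §5 Thm. 5.1; [Markman2025SurveySecant] Cor. 1.3; [GortzWedhorn2023] Thm. 27.291; [Milne1999] §7.
-/

noncomputable section

open CategoryTheory CategoryTheory.Limits AlgebraicGeometry Topology MonoidalCategory CartesianMonoidalCategory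

namespace Summit.HodgeConjecture.HodgeConjecture.Ring2.SemiregularRepresentatives

set_option linter.dupNamespace false -- the cell's namespace repeats the summit name, as in every `Ring2*` file

open Literature.AlgebraicGeometry Literature.AlgebraicGeometry.Motives Literature.AlgebraicGeometry.HodgeTheory
open Literature.AlgebraicTopology.SingularHomology
open Literature.AlgebraicGeometry.Andre1996 (andre1996_cmAnchoredPencil IsCMAnchoredPencilFor compactPencil_dim_eq_of_iso
  compactPencil_irreducibleSpace_base compactPencil_smooth_base compactPencil_exists_abelianVariety_fiber_dim)
open Literature.AlgebraicGeometry.Milne1999 (CMHodgeHypothesisAt)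
open Summit.Ventures.HSemireg (ObjClass LocalVariationalHodgeFor)
open Summit.HodgeConjecture.HodgeConjecture.Ring2.Hypotheses (AbelianSchemeVHC)
open Summit.HodgeConjecture.HodgeConjecture.Ring2.Binders
open Summit.HodgeConjecture.HodgeConjecture.Ring2.ClassTargets

variable {𝒳 S : SchemeOver ℂ}

/-! ## §1 The window engine at fixed relative dimension `n` (per pencil) -/

/-- **(U)'s conclusion at `(n, p)`, `2 ≤ p`, `2p ≤ n`, from the diagonal cells of the WINDOW `n ≤ 2m`, `m + 2 ≤ n`**: the cell
`(n, n/2)` itself if `2p = n`, else pad by `B` of dimension `n − 2p` and use the cell `(2(n − p), n − p)` (part X-a §§1–3).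
[cite: BrosnanFangNiePearlstein2009, §6 Lemma 48] [cite: Lieberman1968, main theorem] [cite: BuchweitzFlenner2003, §5 Thm. 5.1] -/
theorem not_countable_algebraicityLocus_of_window_of_lowerHalf {𝒪 : ObjClass} (hT : LocalVariationalHodgeFor 𝒪) {n : ℕ}
    (hSR : ∀ m : ℕ, n ≤ 2 * m → m + 2 ≤ n → AdmissibleRepresentativesLefAtDeg 𝒪 (2 * m) m)
    (f : 𝒳 ⟶ S) (hf : IsSmoothProjectiveFamily f n) (h𝒳 : IsQuasiProjectiveOver 𝒳)
    [IrreducibleSpace S.left] [IsAffine S.left] [AlgebraicGeometry.Smooth S.hom] (hdim : topologicalKrullDim S.left = 1)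
    (habel : ∀ s : ComplexPoints S, ∃ A' : AbelianVariety ℂ, A'.dim = n ∧ Nonempty (A'.X ≅ fiberOver f s))
    (he : ∃ e : S ⟶ 𝒳, e ≫ f = 𝟙 S) {p : ℕ} (hp2 : 2 ≤ p) (hpn : 2 * p ≤ n) (W : complexBetti 𝒳 (2 * p))
    (hW : ∀ s : ComplexPoints S, IsRationalClass (complexBetti.map (fiberι f s) (2 * p) W) ∧
      IsOfHodgeType n (fiberOver f s) (2 * p) p p (complexBetti.map (fiberι f s) (2 * p) W))
    {s₀ : ComplexPoints S} (hs₀ : complexBetti.map (fiberι f s₀) (2 * p) W ∈ algebraicClasses (fiberOver f s₀) p) :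
    ¬ {s : ComplexPoints S |
        complexBetti.map (fiberι f s) (2 * p) W ∈ algebraicClasses (fiberOver f s) p}.Countable := by
  haveI : LocallyOfFiniteType S.hom := inferInstance
  haveI : IsSeparated S.hom := (IsQuasiProjectiveOver.of_isAffine S).isSeparated
  rcases Nat.eq_or_lt_of_le hpn with hmid | hlt
  · subst hmid
    exact not_countable_algebraicityLocus_of_lefAtDeg hT (hSR p le_rfl (by omega)) f hf h𝒳 hdim habel he W hW hs₀
  · obtain ⟨B, hB⟩ := exists_abelianVariety_dim_eq_succ ℂ (n - 2 * p - 1)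
    have hpB : 2 * p + B.dim = n := by omega
    obtain ⟨hf', habel', W', hW', hiff⟩ := exists_middleLift f hf h𝒳 habel B hpB W hW
    have hmid : n + B.dim = 2 * (p + B.dim) := by omega
    rw [hmid] at hf' habel' hW'
    have h := not_countable_algebraicityLocus_of_lefAtDeg hT (hSR (p + B.dim) (by omega) (by omega)) (fst 𝒳 B.X ≫ f) hf'
      (isQuasiProjectiveOver_tensor h𝒳 (AbelianVariety.isSmoothProjective_holds (A := B)).isProjectiveOver) hdim habel'
      (exists_section_fst_comp f he B) W' hW' ((hiff s₀).2 hs₀)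
    have hset : {s : ComplexPoints S | complexBetti.map (fiberι (fst 𝒳 B.X ≫ f) s) (2 * (p + B.dim)) W' ∈
          algebraicClasses (fiberOver (fst 𝒳 B.X ≫ f) s) (p + B.dim)} =
        {s : ComplexPoints S | complexBetti.map (fiberι f s) (2 * p) W ∈ algebraicClasses (fiberOver f s) p} :=
      Set.ext fun s => hiff s
    rwa [hset] at h

/-- **(U)'s conclusion at every mid-range `(n, p)`, `2 ≤ p ≤ n − 2`, from the window `n ≤ 2m`, `m + 2 ≤ n`** (above the middle:
the lower shadow of codimension `n − p ≥ 2` first). [cite: KerrPearlstein2011, §3.1] [cite: Lieberman1968, main theorem]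
[cite: BrosnanFangNiePearlstein2009, §6 Lemma 48] -/
theorem not_countable_algebraicityLocus_of_window {𝒪 : ObjClass} (hT : LocalVariationalHodgeFor 𝒪) {n : ℕ}
    (hSR : ∀ m : ℕ, n ≤ 2 * m → m + 2 ≤ n → AdmissibleRepresentativesLefAtDeg 𝒪 (2 * m) m)
    (f : 𝒳 ⟶ S) (hf : IsSmoothProjectiveFamily f n) (h𝒳 : IsQuasiProjectiveOver 𝒳)
    [IrreducibleSpace S.left] [IsAffine S.left] [AlgebraicGeometry.Smooth S.hom] (hdim : topologicalKrullDim S.left = 1)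
    (habel : ∀ s : ComplexPoints S, ∃ A' : AbelianVariety ℂ, A'.dim = n ∧ Nonempty (A'.X ≅ fiberOver f s))
    (he : ∃ e : S ⟶ 𝒳, e ≫ f = 𝟙 S) {p : ℕ} (hp2 : 2 ≤ p) (hpn : p + 2 ≤ n) (W : complexBetti 𝒳 (2 * p))
    (hW : ∀ s : ComplexPoints S, IsRationalClass (complexBetti.map (fiberι f s) (2 * p) W) ∧
      IsOfHodgeType n (fiberOver f s) (2 * p) p p (complexBetti.map (fiberι f s) (2 * p) W))
    {s₀ : ComplexPoints S} (hs₀ : complexBetti.map (fiberι f s₀) (2 * p) W ∈ algebraicClasses (fiberOver f s₀) p) :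
    ¬ {s : ComplexPoints S |
        complexBetti.map (fiberι f s) (2 * p) W ∈ algebraicClasses (fiberOver f s) p}.Countable := by
  haveI : LocallyOfFiniteType S.hom := inferInstance
  by_cases hpn' : 2 * p ≤ n
  · exact not_countable_algebraicityLocus_of_window_of_lowerHalf hT hSR f hf h𝒳 hdim habel he hp2 hpn' W hW hs₀
  · obtain ⟨q, j, hqj, hp⟩ : ∃ q j : ℕ, 2 * q + j = n ∧ q + j = p := ⟨n - p, 2 * p - n, by omega, by omega⟩
    subst hp
    obtain ⟨W', hW', hiff⟩ := exists_lowerShadow f hf h𝒳 (IsQuasiProjectiveOver.of_isAffine S) ‹_› habel hqj W hW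
    have h := not_countable_algebraicityLocus_of_window_of_lowerHalf hT hSR f hf h𝒳 hdim habel he (p := q) (by omega)
      (by omega) W' hW' ((hiff s₀).2 hs₀)
    have hset : {s : ComplexPoints S | complexBetti.map (fiberι f s) (2 * q) W' ∈ algebraicClasses (fiberOver f s) q} =
        {s : ComplexPoints S | complexBetti.map (fiberι f s) (2 * (q + j)) W ∈
          algebraicClasses (fiberOver f s) (q + j)} :=
      Set.ext fun s => hiff s
    rwa [hset] at h

/-- **VHC ON EVERY FIBRE of a one-parameter abelian scheme of relative dimension `n` (affine curve base, section, quasi-projective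
total space) from the door and the window at `n`**, in EVERY codimension: off the middle range every fibre is algebraic (part W's
`mem_algebraicClasses_and_divisorClassesSpan_of_offMidRange`); in the middle range the locus is uncountable (§1), hence thick, hence
everything (the tree's closing lemma `Theorems.mem_algebraicClasses_of_thickSet` with the PROVED relative-Hilbert-scheme input).
[cite: CharlesSchnell2014Notes, Prop. 11.3.11 (proof)] [cite: VoisinHodgeII2003, §7.3.2] [cite: VoisinHodgeI2002, Thm. 11.30] -/
theorem forall_mem_algebraicClasses_oneParameter_of_window {𝒪 : ObjClass} (hT : LocalVariationalHodgeFor 𝒪) {n : ℕ}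
    (hSR : ∀ m : ℕ, n ≤ 2 * m → m + 2 ≤ n → AdmissibleRepresentativesLefAtDeg 𝒪 (2 * m) m)
    (f : 𝒳 ⟶ S) (hf : IsSmoothProjectiveFamily f n) (h𝒳 : IsQuasiProjectiveOver 𝒳)
    [IrreducibleSpace S.left] [IsAffine S.left] [AlgebraicGeometry.Smooth S.hom] (hdim : topologicalKrullDim S.left = 1)
    (habel : ∀ s : ComplexPoints S, ∃ A' : AbelianVariety ℂ, A'.dim = n ∧ Nonempty (A'.X ≅ fiberOver f s))
    (he : ∃ e : S ⟶ 𝒳, e ≫ f = 𝟙 S) (p : ℕ) (W : complexBetti 𝒳 (2 * p))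
    (hW : ∀ s : ComplexPoints S, IsRationalClass (complexBetti.map (fiberι f s) (2 * p) W) ∧
      IsOfHodgeType n (fiberOver f s) (2 * p) p p (complexBetti.map (fiberι f s) (2 * p) W))
    {s₀ : ComplexPoints S} (hs₀ : complexBetti.map (fiberι f s₀) (2 * p) W ∈ algebraicClasses (fiberOver f s₀) p)
    (s : ComplexPoints S) : complexBetti.map (fiberι f s) (2 * p) W ∈ algebraicClasses (fiberOver f s) p := by
  haveI : LocallyOfFiniteType S.hom := inferInstance
  by_cases hoff : p ≤ 1 ∨ n ≤ p + 1
  · exact (mem_algebraicClasses_and_divisorClassesSpan_of_offMidRange (hf.isSmoothProjective s) hoff _ (hW s).1 (hW s).2).1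
  · exact Theorems.mem_algebraicClasses_of_thickSet charlesSchnell_algebraicityLocus_iUnion_closed_holds f hf h𝒳
      (IsQuasiProjectiveOver.of_isAffine S) ‹_› W
      {t : ComplexPoints S | complexBetti.map (fiberι f t) (2 * p) W ∈ algebraicClasses (fiberOver f t) p}
      (curve_not_subset_iUnion_of_not_countable hdim _
        (not_countable_algebraicityLocus_of_window hT hSR f hf h𝒳 hdim habel he (by omega) (by omega) W hW hs₀))
      (fun t ht => ht) s

/-! ## §2 From one-parameter abelian schemes to every base with a section, at FIXED relative dimension `n` -/

/-- **VHC on every abelian-fibred family OF RELATIVE DIMENSION `n` WITH A SECTION over a smooth irreducible base, from the door, the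
window at `n` and the curve residual.** The AnchorTransport curve reduction `Theorems.variationalHodge_of_curveBase_of_stable` (affine
opens, then Mumford's curve through two points — the tree THEOREM `mumford_smoothCurve_through_two_points_holds`) for the class of
families «every complex fibre is an abelian variety OF DIMENSION `n`, and a section exists», stable under base change
(`fiberOverFamilyPullbackIso`, `exists_section_familyPullback`); the dimension clause pins the relative dimension of the curve families
(`dim_eq_of_iso_fiberOver`), whose total spaces are quasi-projective by the residual, so §1 applies at the SAME `n`.
[cite: MumfordAV1970, §6 Lemma] [cite: CharlesSchnell2014Notes, Prop. 11.3.11 (proof)] [cite: GortzWedhorn2023, Thm. 27.291] -/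
theorem forall_mem_algebraicClasses_of_window_of_section {𝒪 : ObjClass} (hT : LocalVariationalHodgeFor 𝒪) {n : ℕ}
    (hSR : ∀ m : ℕ, n ≤ 2 * m → m + 2 ≤ n → AdmissibleRepresentativesLefAtDeg 𝒪 (2 * m) m)
    (hqp : OneParameterAbelianSchemeQuasiProjective) (f : 𝒳 ⟶ S) (hf : IsSmoothProjectiveFamily f n)
    (hirr : IrreducibleSpace S.left) (hsm : AlgebraicGeometry.Smooth S.hom)
    (habel : ∀ s : ComplexPoints S, ∃ A' : AbelianVariety ℂ, A'.dim = n ∧ Nonempty (A'.X ≅ fiberOver f s))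
    (he : ∃ e : S ⟶ 𝒳, e ≫ f = 𝟙 S) (p : ℕ) (W : complexBetti 𝒳 (2 * p))
    (hW : ∀ s : ComplexPoints S, IsRationalClass (complexBetti.map (fiberι f s) (2 * p) W) ∧
      IsOfHodgeType n (fiberOver f s) (2 * p) p p (complexBetti.map (fiberι f s) (2 * p) W))
    (hs₀ : ∃ s₀ : ComplexPoints S, complexBetti.map (fiberι f s₀) (2 * p) W ∈ algebraicClasses (fiberOver f s₀) p)
    (s : ComplexPoints S) : complexBetti.map (fiberι f s) (2 * p) W ∈ algebraicClasses (fiberOver f s) p := by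
  refine Theorems.variationalHodge_of_curveBase_of_stable mumford_smoothCurve_through_two_points_holds
    (fun 𝒳' S' f' => (∀ s' : ComplexPoints S', ∃ A' : AbelianVariety ℂ, A'.dim = n ∧ Nonempty (A'.X ≅ fiberOver f' s')) ∧
      ∃ e' : S' ⟶ 𝒳', e' ≫ f' = 𝟙 S')
    (fun 𝒳' S' S'' f' g hQ => ⟨fun s' => ?_, exists_section_familyPullback f' g hQ.2⟩)
    (fun n' 𝒳' S' f' hf' hQ hirr' haff' hsm' hdim' p' A hA hA₀ s' => ?_) f hf ⟨habel, he⟩ hirr hsm p W hW hs₀ s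
  · obtain ⟨A', hd, ⟨e⟩⟩ := hQ.1 (AlgPoints.map g s')
    exact ⟨A', hd, ⟨e ≪≫ (fiberOverFamilyPullbackIso f' g s').symm⟩⟩
  · obtain ⟨s₀', hs₀'⟩ := hA₀
    obtain ⟨A', hd, ⟨e⟩⟩ := hQ.1 s₀'
    have hn : n' = n := (dim_eq_of_iso_fiberOver hf' e).symm.trans hd
    subst hn
    haveI := hirr'
    haveI := haff'
    haveI := hsm'
    exact forall_mem_algebraicClasses_oneParameter_of_window hT hSR f' hf' (hqp f' hf' hirr' haff' hsm' hdim' hQ.1 hQ.2) hdim'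
      hQ.1 hQ.2 p' A hA hs₀' s'

/-- **VHC on every COMPACT pencil of abelian varieties of relative dimension `n`** (André's «pinceau compact»: they carry a section)
from the door, the window at `n` and the curve residual — Abdulali's `InvariantCyclesHoldFor f n`.
[cite: Andre1996Motifs, §6.3 footnote (2) and Lemme 6.3.1] [cite: Abdulali1994FamiliesAV, (1.1) (p. 1122)] [cite: MumfordAV1970, §6 Lemma] -/
theorem invariantCyclesHoldFor_compactPencil_of_window {𝒪 : ObjClass} (hT : LocalVariationalHodgeFor 𝒪) {n : ℕ}
    (hSR : ∀ m : ℕ, n ≤ 2 * m → m + 2 ≤ n → AdmissibleRepresentativesLefAtDeg 𝒪 (2 * m) m)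
    (hqp : OneParameterAbelianSchemeQuasiProjective) {f : 𝒳 ⟶ S} (hf : IsCompactAbelianPencil f n) :
    Literature.AlgebraicGeometry.Abdulali1994.InvariantCyclesHoldFor f n :=
  fun p W hW hs₀ s => forall_mem_algebraicClasses_of_window_of_section hT hSR hqp f hf.isSmoothProjectiveFamily
    (compactPencil_irreducibleSpace_base hf) (compactPencil_smooth_base hf) (compactPencil_exists_abelianVariety_fiber_dim hf)
    hf.exists_section p W hW hs₀ s

/-! ## §3 Per abelian variety: Lemme 6.3.1 + `HC_CM` at dimension `2g` + the window `g ≤ m ≤ 2g − 2` -/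

/-- **HC for ONE abelian variety `A` of dimension `g` from Lemme 6.3.1, `HC_CM` AT DIMENSION `2g`, the door, the curve residual and the
crux on the diagonal cells `(2m, m)` with `g ≤ m ≤ 2g − 2`.** André's step a) / Abdulali's Lemma 6.2 for one `A` (the tree's
`hodgeConjecture_abelian_of_cmAnchoredPencil`, pencil by pencil): codimensions `p ≤ 1`, `p ≥ g − 1` of `A` are divisorial (part W);
otherwise Lemme 6.3.1 gives a compact pencil of relative dimension `2g` through `q·c` (`q ≠ 0`) with a CM fibre `𝒳_t ≅ A₀.X`,
`dim A₀ = 2g`, where `HC_CM` makes `W|_t` algebraic; §2 transports along the pencil; `e₁`, `g` bring it back to `A`.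
[cite: Andre1996Motifs, Lemme 6.3.1 (p. 31) and §6.3 a) (p. 33)] [cite: Abdulali1994FamiliesAV, Lemma 6.2 (p. 1131)] [cite: Milne1999, §7 p. 72] -/
theorem hodgeConjectureFor_of_HC_CM_of_cmAnchoredPencil_of_window (h₂₁ : andre1996_cmAnchoredPencil) {𝒪 : ObjClass}
    (hT : LocalVariationalHodgeFor 𝒪) (hqp : OneParameterAbelianSchemeQuasiProjective) (A : AbelianVariety ℂ)
    (hCM : ∀ A₀ : AbelianVariety ℂ, A₀.dim = 2 * A.dim → CMHodgeHypothesisAt A₀)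
    (hSR : ∀ m : ℕ, A.dim ≤ m → m + 2 ≤ 2 * A.dim → AdmissibleRepresentativesLefAtDeg 𝒪 (2 * m) m) :
    HodgeConjectureFor A.dim A.X := by
  have hA : IsSmoothProjective A.dim A.X := AbelianVariety.isSmoothProjective_holds
  refine (hodgeConjectureFor_iff_of_isSmoothProjective nonempty_hodgeModel_holds hA).2 ?_
  intro p c hc hpp
  by_cases hoff : p ≤ 1 ∨ A.dim ≤ p + 1
  · exact (mem_algebraicClasses_and_divisorClassesSpan_of_offMidRange hA hoff c hc hpp).1
  obtain ⟨𝒳, S, f, hf, s, t, W, A₁, A₀, e₁, g, q, hW, hq, hgc, ⟨e₀⟩, hA₀⟩ := h₂₁ A hA p c hc hpp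
  -- the CM fibre `𝒳_t ≅ A₀.X`: `A₀` is smooth projective of dimension `dim A₀ = 2 dim A`
  have hA₀sp : IsSmoothProjective A₀.dim A₀.X := AbelianVariety.isSmoothProjective_holds
  have hdim : A₀.dim = 2 * A.dim := compactPencil_dim_eq_of_iso hf e₀
  -- `HC_CM` at `A₀`, moved to the fibre `𝒳_t` along `e₀`
  have h₀ : complexBetti.map (fiberι f t) (2 * p) W ∈ algebraicClasses (fiberOver f t) p := by
    have hHC := (hCM A₀ hdim hA₀sp hA₀).2 p
    rw [hdim] at hHC
    exact (forall_hodgeClass_mem_algebraicClasses_iff_of_iso e₀ p).1 hHC _ (hW t).1 (hW t).2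
  -- transport along the pencil (relative dimension `2 dim A`) from `t` to `s`: the window at `2 dim A`
  have h₁ := invariantCyclesHoldFor_compactPencil_of_window hT (n := 2 * A.dim)
    (fun m hm hm' => hSR m (by omega) hm') hqp hf p W hW ⟨t, h₀⟩ s
  have h₂ : complexBetti.map e₁.hom (2 * p) (complexBetti.map (fiberι f s) (2 * p) W) ∈ algebraicClasses A₁.X p :=
    (mem_algebraicClasses_map_iff_of_iso e₁).2 h₁
  have h₃ : (q : ℂ) • c ∈ algebraicClasses A.X p := by
    rw [← hgc]
    exact map_mem_algebraicClasses_of_abelianVariety hA A₁ g.hom.hom.hom h₂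
  exact (Submodule.smul_mem_iff _ (Rat.cast_ne_zero.2 hq)).1 h₃

/-! ## §4 The rows: `HCAtDim g` from the window, `HC_AV` from the diagonal `m ≥ 4` (fact-free) / `m ≥ 6` (mod Markman ≤ 5) -/

/-- **`HCAtDim g` — HC for complex abelian varieties of dimension `g` — from Lemme 6.3.1, `HC_CM` at dimension `2g`, the door, the curve
residual and the crux on the diagonal cells `(2m, m)`, `g ≤ m ≤ 2g − 2`.** For `g = 6`: the cells `(12,6), (14,7), …, (20,10)` — and NOT
`(6,3)`. [cite: Andre1996Motifs, Lemme 6.3.1 (p. 31) and §6.3 a) (p. 33)] [cite: Abdulali1994FamiliesAV, Lemma 6.2 (p. 1131)] -/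
theorem hcAtDim_of_HC_CM_of_lefAtDeg_window (g : ℕ) (h₂₁ : andre1996_cmAnchoredPencil) {𝒪 : ObjClass}
    (hT : LocalVariationalHodgeFor 𝒪) (hqp : OneParameterAbelianSchemeQuasiProjective)
    (hCM : ∀ A₀ : AbelianVariety ℂ, A₀.dim = 2 * g → CMHodgeHypothesisAt A₀)
    (hSR : ∀ m : ℕ, g ≤ m → m + 2 ≤ 2 * g → AdmissibleRepresentativesLefAtDeg 𝒪 (2 * m) m) : HCAtDim g := by
  intro A hAg
  have hg : A.dim = g := hAg
  exact hodgeConjectureFor_of_HC_CM_of_cmAnchoredPencil_of_window h₂₁ hT hqp A (fun A₀ h₀ => hCM A₀ (by rw [h₀, hg]))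
    fun m hm hm' => hSR m (by omega) (by omega)

/-- **`HC_AV` from `HC_CM`, Lemme 6.3.1, the door, the curve residual and the crux on the diagonal cells `(2m, m)`, `m ≥ 4` — FACT-FREE
otherwise** (dimensions `≤ 3`: `hcAtDim_of_le_three`; `g ≥ 4`: the window `g ≤ m`). Part X-a needed `m ≥ 2` with Lemmes 6.3.2–6.3.3
in place of `HC_CM`. [cite: Andre1996Motifs, Lemme 6.3.1 (p. 31) and §6.3 a) (p. 33)] [cite: Abdulali1994FamiliesAV, Lemma 6.2]
[cite: VoisinHodgeII2003, §10.2.3 proof of Prop. 10.26] -/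
theorem hc_av_of_HC_CM_of_lefAtDeg_diagonal_four (h₂₁ : andre1996_cmAnchoredPencil) {𝒪 : ObjClass}
    (hT : LocalVariationalHodgeFor 𝒪) (hqp : OneParameterAbelianSchemeQuasiProjective) (hCM : Theses.RankFourFaces.CMAbelianHodge)
    (hSR : ∀ m : ℕ, 4 ≤ m → AdmissibleRepresentativesLefAtDeg 𝒪 (2 * m) m) :
    Theses.PadicSemiregularLift.HodgeAbelianVarieties := by
  refine hodgeAbelianVarieties_iff_forall_hcAtDim.2 fun g => ?_
  rcases Nat.lt_or_ge g 4 with hg | hg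
  · exact hcAtDim_of_le_three (by omega)
  · exact hcAtDim_of_HC_CM_of_lefAtDeg_window g h₂₁ hT hqp (fun A₀ _ => hCM A₀) fun m hm _ => hSR m (by omega)

/-- **`HC_AV` from `HC_CM`, Lemme 6.3.1, the door, the curve residual, `HCUpToDim 5` (Markman 2025 Cor. 1.3, UNREFEREED) and the crux
on the diagonal cells `(2m, m)`, `m ≥ 6`.** In the cell's framing the minimal statement of road b02 next to `HC_CM`: K-C ∧ door ∧
«regime 2 on the diagonal from `(12, 6)` on» (part X-a: from `(6, 3)` on, with Lemmes 6.3.2–6.3.3 instead of `HC_CM`).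
[cite: Andre1996Motifs, Lemme 6.3.1 (p. 31) and §6.3 a) (p. 33)] [cite: Markman2025SurveySecant, Cor. 1.3] [cite: Abdulali1994FamiliesAV, Lemma 6.2] -/
theorem hc_av_of_HC_CM_of_hcUpToDim_five_of_lefAtDeg_diagonal_six (h₂₁ : andre1996_cmAnchoredPencil) {𝒪 : ObjClass}
    (hT : LocalVariationalHodgeFor 𝒪) (hqp : OneParameterAbelianSchemeQuasiProjective) (hCM : Theses.RankFourFaces.CMAbelianHodge)
    (h₅ : HCUpToDim 5) (hSR : ∀ m : ℕ, 6 ≤ m → AdmissibleRepresentativesLefAtDeg 𝒪 (2 * m) m) :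
    Theses.PadicSemiregularLift.HodgeAbelianVarieties := by
  refine hodgeAbelianVarieties_iff_forall_hcAtDim.2 fun g => ?_
  rcases Nat.lt_or_ge g 6 with hg | hg
  · exact hcAtDim_of_hcUpToDim (hcUpToDim_mono (by omega) h₅)
  · exact hcAtDim_of_HC_CM_of_lefAtDeg_window g h₂₁ hT hqp (fun A₀ _ => hCM A₀) fun m hm _ => hSR m (by omega)

/-- **The `closes`-shape over the TWISTED door, `HC_CM`-load-bearing, FACT-FREE otherwise**: `HC_AV` from K-C, `HC_CM`, the twisted door,
Raynaud, Lemme 6.3.1 and regime 2 on the diagonal cells `(2m, m)`, `m ≥ 4`. [cite: Andre1996Motifs, Lemme 6.3.1 (p. 31)]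
[cite: Pridham2024Semiregularity, Cor. 2.25 and Rem. 2.27] [cite: GortzWedhorn2023, Thm. 27.291] [cite: Abdulali1994FamiliesAV, Lemma 6.2] -/
theorem hc_av_of_HC_CM_of_exceptionalRegimeAt_twisted_diagonal_four (hC : ChernCharacterOnBetti)
    {Adm : PerfectAdmissibility} (hAdm : ∀ n X₀ I E, bfSingleAdmissible n X₀ I E → Adm n X₀ I E)
    (hCM : Theses.RankFourFaces.CMAbelianHodge)
    (hDiag : ∀ (C : ChernCharacterBetti) (m : ℕ), 4 ≤ m → LefAtExceptionalRegimeAt (twistedReflexiveClass C Adm) (2 * m) m)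
    (hDoor : ∀ C : ChernCharacterBetti, TwistedPerfectDoorVHC C Adm)
    (hR : raynaud1970_abelianScheme_section_projective) (h₂₁ : andre1996_cmAnchoredPencil) :
    Theses.PadicSemiregularLift.HodgeAbelianVarieties := by
  obtain ⟨C⟩ := hC
  exact hc_av_of_HC_CM_of_lefAtDeg_diagonal_four h₂₁ (𝒪 := twistedReflexiveClass C Adm) (hDoor C)
    (oneParameterAbelianSchemeQuasiProjective_of_raynaud1970 hR) hCM
    fun m hm => admissibleRepresentativesLefAtDeg_twisted_of_exceptionalRegimeAt C hAdm (hDiag C m hm)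

/-- **The `closes`-shape over the TWISTED door, `HC_CM`-load-bearing, from `(12, 6)` on**: `HC_AV` from K-C, `HC_CM`, the twisted door,
Raynaud, Lemme 6.3.1, `HCUpToDim 5` (Markman 2025 Cor. 1.3, UNREFEREED) and regime 2 on the diagonal cells `(2m, m)`, `m ≥ 6`.
[cite: Andre1996Motifs, Lemme 6.3.1 (p. 31)] [cite: Markman2025SurveySecant, Cor. 1.3] [cite: Pridham2024Semiregularity, Cor. 2.25 and Rem. 2.27]
[cite: GortzWedhorn2023, Thm. 27.291] -/
theorem hc_av_of_HC_CM_of_hcUpToDim_five_of_exceptionalRegimeAt_twisted_diagonal_six (hC : ChernCharacterOnBetti)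
    {Adm : PerfectAdmissibility} (hAdm : ∀ n X₀ I E, bfSingleAdmissible n X₀ I E → Adm n X₀ I E)
    (hCM : Theses.RankFourFaces.CMAbelianHodge) (h₅ : HCUpToDim 5)
    (hDiag : ∀ (C : ChernCharacterBetti) (m : ℕ), 6 ≤ m → LefAtExceptionalRegimeAt (twistedReflexiveClass C Adm) (2 * m) m)
    (hDoor : ∀ C : ChernCharacterBetti, TwistedPerfectDoorVHC C Adm)
    (hR : raynaud1970_abelianScheme_section_projective) (h₂₁ : andre1996_cmAnchoredPencil) :
    Theses.PadicSemiregularLift.HodgeAbelianVarieties := by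
  obtain ⟨C⟩ := hC
  exact hc_av_of_HC_CM_of_hcUpToDim_five_of_lefAtDeg_diagonal_six h₂₁ (𝒪 := twistedReflexiveClass C Adm) (hDoor C)
    (oneParameterAbelianSchemeQuasiProjective_of_raynaud1970 hR) hCM h₅
    fun m hm => admissibleRepresentativesLefAtDeg_twisted_of_exceptionalRegimeAt C hAdm (hDiag C m hm)

/-- ON-PATH bookkeeping: every hypothesis slice used above is implied by `HC_AV` except the crux cells and the door (`HC_CM` is `HC_AV` on CM
abelian varieties; `HCUpToDim 5` is `HC_AV` in dimension `≤ 5`). [folklore] -/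
theorem hcUpToDim_and_HC_CM_of_hc_av (h : Theses.PadicSemiregularLift.HodgeAbelianVarieties) (G : ℕ) :
    HCUpToDim G ∧ Theses.RankFourFaces.CMAbelianHodge :=
  ⟨fun A _ => hodgeAbelianVarieties_iff_forall_hcAtDim.1 h A.dim A rfl, fun A _ _ => h A⟩

end Summit.HodgeConjecture.HodgeConjecture.Ring2.SemiregularRepresentatives

end
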